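import Mathlib
import Summits.AtomisticToContinuum.HydrodynamicLimit.Theorems.ImplosionDichotomyDenseExcursionPackingAnalyticDefsB

/-!
# `C¹` recovery off the sonic point: the profile envelope on the CORE `x ≤ 1` from the cavity tube
# (crux `DenseExcursion`, stmt-AtomisticToContinuum-12586, line `sonic-cavity-renewal` v7, stub `stub_analyticPackingImplosion`)

Helper file (`--supports stmt-AtomisticToContinuum-12586`, line lead a2, wave-3 worker D, task `derivRecovery_offSonic`).
The pointwise recovery `derivRecovery_pointwise` (`…PackingAnalyticDerivRecoveryPointwise`) needs, at each point off the
sonic window `|x| ≥ ρ₁`, a common bound `A` for `|W|, |W′|, |S′/S|, |S(S′ + S)|` and a constant `K` with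
`1 + S² ≤ K |Δ|`, `Δ = (W − 1)² − S²`. Kernel-checked here, ON THE CORE `x ≤ 1`, from the certified clauses of
`CavityTube` (`…SonicCavityDefs`):

* `core_envelope` (REGISTERED helper): for `x ≤ 1`, `|x| ≥ ρ₁` (`0 < ρ₁ ≤ 1`): `A = 3`, `K = 40/ρ₁`. The four bounds come
  from the `C²` envelope (c) (`|W| ≤ 1/4`, `|W′| ≤ 1/2`, `7/10 ≤ eˣS ≤ 1`, `|(eˣS)′| ≤ 1/4`, so `|S′/S| ≤ 5/14 + 1`) and the
  centre expansion (d) (`|(eˣS)′| ≤ (1/5 + 2e^{2x})e^{2x}` on `x ≤ 0`, so `S(S′+S) = e^{−2x}·eˣS·(eˣS)′` stays `≤ 11/5`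
  although `S ∼ e^{−x}`); the determinant bound from the sonic clause (a): `|W + S − 1| ≥ (3/8) min(|x|, 1)` with the
  signs `W + S ≷ 1` for `x ≶ 0`, giving `|Δ| ≥ 9ρ₁/32` on `ρ₁ ≤ x ≤ 1`, `|Δ| ≥ (3ρ₁/8)(3/4 + S)` on `−1 ≤ x ≤ −ρ₁`, and
  `|Δ| ≥ (3/28) S²` on `x ≤ −1` (there `S ≥ 7/5`): the weight `S²` on `(u₂/S)′` is exactly what `Δ ≈ −S²` absorbs.

Elementary real inequalities (`Real.add_one_le_exp`, `Real.exp_one_lt_d9`). NOT here: the far field `x ≥ 1` (limits of the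
profile; companion file), the recovery itself, or `Γ`.
-/

noncomputable section

open Set

namespace Summit.AtomisticToContinuum.HydrodynamicLimit.Theorems.PackingAnalyticImplosion

open Summit.AtomisticToContinuum.HydrodynamicLimit.Theorems.R2OneModeTwoConditions
open Summit.AtomisticToContinuum.HydrodynamicLimit.Theorems.SonicCavityRenewal

/-- `(eˣ S)′ = eˣ (S + S′)`. [folklore] -/
theorem deriv_exp_mul {S : ℝ → ℝ} (hS : Differentiable ℝ S) (x : ℝ) :
    deriv (fun y => Real.exp y * S y) x = Real.exp x * (S x + deriv S x) := by
  have h : HasDerivAt (fun y => Real.exp y * S y) (Real.exp x * S x + Real.exp x * deriv S x) x :=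
    (Real.hasDerivAt_exp x).mul (hS x).hasDerivAt
  rw [h.deriv]; ring

/-- `e^{−x} ≥ 2` for `x ≤ −1`. [folklore] -/
theorem two_le_exp_neg {x : ℝ} (hx : x ≤ -1) : 2 ≤ Real.exp (-x) := by
  have h := Real.add_one_le_exp (-x)
  linarith

/-- `e^{−x} ≤ 3` for `−1 ≤ x`. [folklore] -/
theorem exp_neg_le_three {x : ℝ} (hx : -1 ≤ x) : Real.exp (-x) ≤ 3 := by
  have h1 : Real.exp (-x) ≤ Real.exp 1 := Real.exp_le_exp.2 (by linarith)
  have h2 := Real.exp_one_lt_d9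
  linarith

/-- **THE PROFILE ENVELOPE ON THE CORE** (registered helper `core_envelope` of `stub_analyticPackingImplosion`): for a
cavity-tube profile with `S > 0`, at every `x ≤ 1` with `|x| ≥ ρ₁` (`0 < ρ₁ ≤ 1`):
`|W|, |W′|, |S′/S|, |S(S′ + S)| ≤ 3` and `1 + S² ≤ (40/ρ₁) |(W − 1)² − S²|`. [folklore] -/
theorem core_envelope : ∀ (r : ℝ) (W S : ℝ → ℝ) (ρ₁ : ℝ), 0 < ρ₁ → ρ₁ ≤ 1 → (∀ x, 0 < S x) → Differentiable ℝ S → CavityTube r W S → ∀ x, x ≤ 1 → ρ₁ ≤ |x| → |W x| ≤ 3 ∧ |deriv W x| ≤ 3 ∧ |deriv S x / S x| ≤ 3 ∧ |S x * (deriv S x + S x)| ≤ 3 ∧ 1 + S x ^ 2 ≤ 40 / ρ₁ * |(W x - 1) ^ 2 - S x ^ 2| := by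
  intro r W S ρ₁ hρ₁ hρ₁1 hSpos hSd hT x hx1 hxρ
  obtain ⟨h0, hneg, hpos, hchord, -, -, -, hcW, hcS, ⟨W₂, s₀, s₂, hW₂, hs₀, hs₀', hs₂, hcentre⟩, -⟩ := hT
  have hS : 0 < S x := hSpos x
  have hS0 : S x ≠ 0 := hS.ne'
  have hex : 0 < Real.exp x := Real.exp_pos x
  obtain ⟨hW, hW', -⟩ := hcW x hx1
  obtain ⟨hs1, hs2, hs3, -⟩ := hcS x hx1
  rw [deriv_exp_mul hSd x] at hs3
  -- `S′/S` and `S(S′ + S)` through `s̃ = eˣ S`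
  have hratio : |deriv S x / S x| ≤ 3 := by
    have e : deriv S x / S x = Real.exp x * (S x + deriv S x) / (Real.exp x * S x) - 1 := by
      field_simp; ring
    rw [e]
    have h1 : |Real.exp x * (S x + deriv S x) / (Real.exp x * S x)| ≤ 1 / 4 / (7 / 10) := by
      rw [abs_div, abs_of_pos (by positivity : 0 < Real.exp x * S x)]
      exact div_le_div₀ (by norm_num) hs3 (by norm_num) hs1
    calc |Real.exp x * (S x + deriv S x) / (Real.exp x * S x) - 1|
        ≤ |Real.exp x * (S x + deriv S x) / (Real.exp x * S x)| + |(1:ℝ)| := abs_sub _ _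
      _ ≤ 1 / 4 / (7 / 10) + 1 := by rw [abs_one]; linarith
      _ ≤ 3 := by norm_num
  have hpress : |S x * (deriv S x + S x)| ≤ 3 := by
    -- `S (S′ + S) = e^{−2x} · (eˣ S) · (eˣ (S + S′))`
    have e : S x * (deriv S x + S x) =
        Real.exp (-x) * Real.exp (-x) * ((Real.exp x * S x) * (Real.exp x * (S x + deriv S x))) := by
      have h3 : Real.exp (-x) * Real.exp x = 1 := by rw [← Real.exp_add]; simp
      linear_combination (-(S x * (deriv S x + S x)) * (Real.exp (-x) * Real.exp x + 1)) * h3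
    rw [e, abs_mul, abs_mul, abs_of_pos (Real.exp_pos _), abs_mul, abs_of_pos (by positivity : 0 < Real.exp x * S x)]
    rcases le_or_gt x 0 with hx0 | hx0
    · -- `x ≤ 0`: the centre expansion bounds `(eˣS)′` by `(1/5 + 2e^{2x}) e^{2x}`
      obtain ⟨-, -, -, -, hd5, -⟩ := hcentre x hx0
      rw [deriv_exp_mul hSd x] at hd5
      have he2 : Real.exp (2 * x) ≤ 1 := by rw [Real.exp_le_one_iff]; linarith
      have he2p : 0 < Real.exp (2 * x) := Real.exp_pos _
      have he4 : Real.exp (4 * x) = Real.exp (2 * x) * Real.exp (2 * x) := by rw [← Real.exp_add]; ring_nf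
      have hb : |Real.exp x * (S x + deriv S x)| ≤ 11 / 5 * Real.exp (2 * x) := by
        have h1 : |Real.exp x * (S x + deriv S x)| ≤ |2 * s₂ * Real.exp (2 * x)| + 2 * Real.exp (4 * x) := by
          have := abs_sub_abs_le_abs_sub (Real.exp x * (S x + deriv S x)) (2 * s₂ * Real.exp (2 * x))
          linarith
        rw [abs_mul (2 * s₂) (Real.exp (2 * x)), abs_mul (2:ℝ) s₂, abs_two, abs_of_pos he2p, he4] at h1
        have hs₂e : |s₂| * Real.exp (2 * x) ≤ 1 / 10 * Real.exp (2 * x) :=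
          mul_le_mul_of_nonneg_right hs₂ he2p.le
        have he22 : Real.exp (2 * x) * Real.exp (2 * x) ≤ 1 * Real.exp (2 * x) :=
          mul_le_mul_of_nonneg_right he2 he2p.le
        linarith
      have hee : Real.exp (-x) * Real.exp (-x) * Real.exp (2 * x) = 1 := by
        rw [← Real.exp_add, ← Real.exp_add]; ring_nf; simp
      calc Real.exp (-x) * Real.exp (-x) * (Real.exp x * S x * |Real.exp x * (S x + deriv S x)|)
          ≤ Real.exp (-x) * Real.exp (-x) * (1 * (11 / 5 * Real.exp (2 * x))) := by
            apply mul_le_mul_of_nonneg_left _ (by positivity)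
            exact mul_le_mul hs2 hb (abs_nonneg _) (by norm_num)
        _ = 11 / 5 := by linear_combination (11 / 5 : ℝ) * hee
        _ ≤ 3 := by norm_num
    · -- `0 < x ≤ 1`: `e^{−x} ≤ 1`
      have he : Real.exp (-x) ≤ 1 := by rw [Real.exp_le_one_iff]; linarith
      have he0 : 0 < Real.exp (-x) := Real.exp_pos _
      calc Real.exp (-x) * Real.exp (-x) * (Real.exp x * S x * |Real.exp x * (S x + deriv S x)|)
          ≤ 1 * 1 * (1 * (1 / 4)) := by gcongr
        _ ≤ 3 := by norm_num
  refine ⟨hW.trans (by norm_num), hW'.trans (by norm_num), hratio, hpress, ?_⟩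
  -- the determinant
  have hSexp : S x = Real.exp (-x) * (Real.exp x * S x) := by
    rw [← mul_assoc, ← Real.exp_add]; simp
  have hWabs := abs_le.mp hW
  have hK0 : (0:ℝ) < 40 / ρ₁ := by positivity
  rcases lt_or_ge 0 x with hx0 | hx0
  · -- `ρ₁ ≤ x ≤ 1`: both factors of `Δ` positive
    have hxρ' : ρ₁ ≤ x := by rwa [abs_of_pos hx0] at hxρ
    have hsum : W x + S x < 1 := hpos x hx0
    have hch := hchord x hx1
    rw [min_eq_left (by rw [abs_of_pos hx0]; exact hx1), abs_of_pos hx0,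
      abs_of_neg (by linarith : W x + S x - 1 < 0)] at hch
    have hSle : S x ≤ 1 := by
      rw [hSexp]
      have he : Real.exp (-x) ≤ 1 := by rw [Real.exp_le_one_iff]; linarith
      calc Real.exp (-x) * (Real.exp x * S x) ≤ 1 * 1 :=
            mul_le_mul he hs2 (by positivity) (by norm_num)
        _ = 1 := by norm_num
    have hΔ : 9 * ρ₁ / 32 ≤ (W x - 1) ^ 2 - S x ^ 2 := by
      have e : (W x - 1) ^ 2 - S x ^ 2 = (1 - W x - S x) * (1 - W x + S x) := by ring
      rw [e]
      have h1 : 3 / 8 * ρ₁ ≤ 1 - W x - S x := by linarith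
      have h2 : 3 / 4 ≤ 1 - W x + S x := by linarith
      calc 9 * ρ₁ / 32 = (3 / 8 * ρ₁) * (3 / 4) := by ring
        _ ≤ (1 - W x - S x) * (1 - W x + S x) := mul_le_mul h1 h2 (by norm_num) (by linarith)
    rw [abs_of_pos (by linarith)]
    have hS2 : S x ^ 2 ≤ 1 := by nlinarith only [hSle, hS.le]
    calc 1 + S x ^ 2 ≤ 2 := by linarith only [hS2]
      _ ≤ 40 / ρ₁ * (9 * ρ₁ / 32) := by
          rw [show 40 / ρ₁ * (9 * ρ₁ / 32) = 45 / 4 by field_simp; ring]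
          norm_num
      _ ≤ 40 / ρ₁ * ((W x - 1) ^ 2 - S x ^ 2) := mul_le_mul_of_nonneg_left hΔ hK0.le
  · -- `x ≤ −ρ₁ < 0`: `Δ < 0`, `|Δ| = (W + S − 1)(1 − W + S)`
    have hxne : x ≠ 0 := by
      intro h; rw [h, abs_zero] at hxρ; linarith
    have hxlt : x < 0 := lt_of_le_of_ne hx0 hxne
    have hxρ' : ρ₁ ≤ -x := by rwa [abs_of_neg hxlt] at hxρ
    have hsum : 1 < W x + S x := hneg x hxlt
    have hΔneg : (W x - 1) ^ 2 - S x ^ 2 < 0 := by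
      have hp := mul_pos (show 0 < S x - (1 - W x) by linarith) (show 0 < S x + (1 - W x) by linarith)
      linarith only [hp]
    rw [abs_of_neg hΔneg]
    have e : -((W x - 1) ^ 2 - S x ^ 2) = (W x + S x - 1) * (1 - W x + S x) := by ring
    rw [e]
    have hch := hchord x hx1
    rw [abs_of_pos (by linarith : 0 < W x + S x - 1), abs_of_neg hxlt] at hch
    rcases le_or_gt (-1) x with hx1' | hx1'
    · -- `−1 ≤ x ≤ −ρ₁`
      rw [min_eq_left (by linarith)] at hch
      have hS3 : S x ≤ 3 := by
        rw [hSexp]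
        calc Real.exp (-x) * (Real.exp x * S x) ≤ 3 * 1 :=
              mul_le_mul (exp_neg_le_three hx1') hs2 (by positivity) (by norm_num)
          _ = 3 := by norm_num
      have h1 : 3 / 8 * ρ₁ ≤ W x + S x - 1 := by linarith
      have h2 : 3 / 4 + S x ≤ 1 - W x + S x := by linarith
      have hprod : (3 / 8 * ρ₁) * (3 / 4 + S x) ≤ (W x + S x - 1) * (1 - W x + S x) :=
        mul_le_mul h1 h2 (by positivity) (by linarith)
      have hq : 1 + S x ^ 2 ≤ 13 / 3 * (3 / 4 + S x) := by
        have hm := mul_nonneg hS.le (show 0 ≤ 3 - S x by linarith)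
        linarith only [hm, hS]
      calc 1 + S x ^ 2 ≤ 13 / 3 * (3 / 4 + S x) := hq
        _ ≤ 40 / ρ₁ * ((3 / 8 * ρ₁) * (3 / 4 + S x)) := by
            rw [show 40 / ρ₁ * ((3 / 8 * ρ₁) * (3 / 4 + S x)) = 15 * (3 / 4 + S x) by field_simp; ring]
            linarith only [hS]
        _ ≤ 40 / ρ₁ * ((W x + S x - 1) * (1 - W x + S x)) := mul_le_mul_of_nonneg_left hprod hK0.le
    · -- `x < −1`: `S ≥ 7/5`
      have hS75 : 7 / 5 ≤ S x := by
        rw [hSexp]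
        calc (7 / 5 : ℝ) = 2 * (7 / 10) := by norm_num
          _ ≤ Real.exp (-x) * (Real.exp x * S x) :=
              mul_le_mul (two_le_exp_neg hx1'.le) hs1 (by norm_num) (by positivity)
      have h1 : 3 / 28 * S x ≤ W x + S x - 1 := by linarith only [hWabs.1, hS75]
      have h2 : S x ≤ 1 - W x + S x := by linarith
      have hprod : (3 / 28 * S x) * S x ≤ (W x + S x - 1) * (1 - W x + S x) :=
        mul_le_mul h1 h2 hS.le (by linarith)
      have hS2 : (49:ℝ) / 25 ≤ S x ^ 2 := by nlinarith only [hS75]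
      calc 1 + S x ^ 2 ≤ 40 * ((3 / 28 * S x) * S x) := by linarith only [hS2]
        _ ≤ 40 / ρ₁ * ((3 / 28 * S x) * S x) := by
            apply mul_le_mul_of_nonneg_right _ (by positivity)
            rw [le_div_iff₀ hρ₁]; linarith only [hρ₁1]
        _ ≤ 40 / ρ₁ * ((W x + S x - 1) * (1 - W x + S x)) := mul_le_mul_of_nonneg_left hprod hK0.le

end Summit.AtomisticToContinuum.HydrodynamicLimit.Theorems.PackingAnalyticImplosion

end
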